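import Summits.BirchSwinnertonDyer.BirchSwinnertonDyer.Theorems.GenusKolyvaginAtTwoGenusPrimitiveSupplyAtTwoArchimedeanRootNumber
import HarnessLib

/-!
# R-128 retype — print-form twins of `GenusKolyvaginAtTwoGenusPrimitiveSupplyAtTwoArchimedeanRootNumber`

Seat `bsd-line-gk2-p2` g21 (cell `bsd-f1-sign2`), route `GenusKolyvaginAtTwo`, `--supports stmt-BirchSwinnertonDyer-22136`
(helper; closes nothing). Director-bsd R-128 RETYPE ORDER (2026-08-29 17:42Z; bsd-cited U-r05-BX, T-Q381-1′): the four theorems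
`isSquare_twistSelmerTwoCard_mul_selmerTwoCard_mul_two`, `admissibleTwistSelmerShiftAt_of_print`, `admissibleTwistSelmerLevelAt_of_print`,
`strictShaPropagationAt_of_print` of `…ArchimedeanRootNumber` take the BARE closure `∀ V : WeierstrassCurve ℚ, p_parity V 2` (all
Weierstrass cubics, singular included — off print). This file declares their PRIMED TWINS with the hypothesis in print form
`∀ (V : WeierstrassCurve ℚ) [V.IsElliptic], p_parity V 2` (= route item `TwoParityDD` since rev 34), as one-line wrappers over the
`hpar`-free cores landed in the parent (`isSquare_…_of_parity`, `…ShiftAt_of_isSquare`, `…LevelAt_of_isSquare`, `strictShaPropagationAt_of_isSquare`,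
same seat) — the parent is at the 400-line lint, and its own `TwoParityDD` glue now runs through those cores, so no import cycle arises.
THEOREMS ONLY; no definition, no named fact, no `sorry`. BSD is NOT proved by any of this; nothing is closed.
-/

set_option linter.dupNamespace false -- tree convention: `Summit.BirchSwinnertonDyer.BirchSwinnertonDyer.Theorems` (summit = sub-problem)
set_option autoImplicit false

noncomputable section

open scoped Classical ContRepresentation AddSubgroup

namespace Summit.BirchSwinnertonDyer.BirchSwinnertonDyer.Theorems.GenusKolyArch

open WeierstrassCurve Field NumberField IsDedekindDomain Function
open Literature.NumberTheory.EllipticCurves Literature.NumberTheory.GaloisRepresentations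
open Literature.NumberTheory.EllipticCurves.ModularForms (exists_isNewformOf)
open Summit.BirchSwinnertonDyer.Rank1Residual.F1Sign2
open Summit.BirchSwinnertonDyer.BirchSwinnertonDyer.Theorems.GenusKolyTwistLocal

section R128Twins

variable (W : WeierstrassCurve ℚ) [W.IsElliptic] [W.IsGloballyMinimal]

/-- **R-128 retype** (director-bsd 2026-08-29, T-Q381-1′) of `isSquare_twistSelmerTwoCard_mul_selmerTwoCard_mul_two`: the SAME statement with
the `2`-parity hypothesis in PRINT form `∀ (V : WeierstrassCurve ℚ) [V.IsElliptic], p_parity V 2`; proof = the parent's per-curve core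
`isSquare_twistSelmerTwoCard_mul_selmerTwoCard_mul_two_of_parity` at the two elliptic curves `W`, `W^{(d)}`.
[cite: DokchitserDokchitserAnnals2010, Thm. 1.4] [cite: Cassels1962ArithmeticIV] [cite: Darmon2004, §3.6 Thm. 3.17] -/
theorem isSquare_twistSelmerTwoCard_mul_selmerTwoCard_mul_two' (hmod : exists_isNewformOf)
    (hpar : ∀ (V : WeierstrassCurve ℚ) [V.IsElliptic], p_parity V 2) (hCT : WeierstrassCurve.exists_casselsTate_pairing (K := ℚ))
    (hT : NoRationalTwoTorsion W) {d : ℤ} (hd : DescAdmissible W d) :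
    IsSquare (twistSelmerTwoCard W d * selmerTwoCard W * 2) :=
  isSquare_twistSelmerTwoCard_mul_selmerTwoCard_mul_two_of_parity W hmod hCT hT hd (hpar W) (hpar _)

/-- **R-128 retype** of `admissibleTwistSelmerShiftAt_of_print` (print-form `2`-parity binder): the T-A dichotomy for ONE curve — `Δ_W > 0`,
`E(ℚ)[2] = 0`, `d` descent-admissible ⟹ `2·#Sel₂(W^{(d)}) = #Sel₂(W)` or `#Sel₂(W^{(d)}) = 2·#Sel₂(W)` — via the parent's
`admissibleTwistSelmerShiftAt_of_isSquare`. [cite: Kramer1981, §2 Prop. 6, Thm. 1] [cite: MazurRubin2010, Cor. 3.4 (i)] [cite: DokchitserDokchitserAnnals2010, Thm. 1.4] -/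
theorem admissibleTwistSelmerShiftAt_of_print' (hmod : exists_isNewformOf) (hpar : ∀ (V : WeierstrassCurve ℚ) [V.IsElliptic], p_parity V 2)
    (hCT : WeierstrassCurve.exists_casselsTate_pairing (K := ℚ)) (hΔ : 0 < W.Δ) (hT : NoRationalTwoTorsion W)
    {d : ℤ} (hd : DescAdmissible W d) :
    2 * twistSelmerTwoCard W d = selmerTwoCard W ∨ twistSelmerTwoCard W d = 2 * selmerTwoCard W :=
  admissibleTwistSelmerShiftAt_of_isSquare W hΔ hd (isSquare_twistSelmerTwoCard_mul_selmerTwoCard_mul_two' W hmod hpar hCT hT hd)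

/-- **R-128 retype** of `admissibleTwistSelmerLevelAt_of_print` (print-form `2`-parity binder): all descent-admissible twists of ONE curve
with `Δ_W > 0`, `E(ℚ)[2] = 0` have the same `#Sel₂` — via the parent's `admissibleTwistSelmerLevelAt_of_isSquare`.
[cite: Kramer1981, §2 Prop. 6, Thm. 1] [cite: MazurRubin2010, Cor. 3.4 (i)] -/
theorem admissibleTwistSelmerLevelAt_of_print' (hmod : exists_isNewformOf) (hpar : ∀ (V : WeierstrassCurve ℚ) [V.IsElliptic], p_parity V 2)
    (hCT : WeierstrassCurve.exists_casselsTate_pairing (K := ℚ)) (hΔ : 0 < W.Δ) (hT : NoRationalTwoTorsion W)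
    {d d' : ℤ} (hd : DescAdmissible W d) (hd' : DescAdmissible W d') : twistSelmerTwoCard W d = twistSelmerTwoCard W d' :=
  admissibleTwistSelmerLevelAt_of_isSquare W hΔ hd hd' (isSquare_twistSelmerTwoCard_mul_selmerTwoCard_mul_two' W hmod hpar hCT hT hd)
    (isSquare_twistSelmerTwoCard_mul_selmerTwoCard_mul_two' W hmod hpar hCT hT hd')

/-- **R-128 retype** of `strictShaPropagationAt_of_print` (print-form `2`-parity binder): the T-V dichotomy for ONE curve — `Δ_W > 0`,
`E(ℚ)[2] = 0`, `#Sel₂(W) = 4` ⟹ every descent-admissible twist has `#Sel₂ = 2`, or every one has `#Sel₂ = 8` — via the parent's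
`strictShaPropagationAt_of_isSquare`. [cite: Kramer1981, §2 Prop. 6, Thm. 1] [cite: MazurRubin2010, Cor. 3.4 (i)] [cite: CremonaMazur2000, §3] -/
theorem strictShaPropagationAt_of_print' (hmod : exists_isNewformOf) (hpar : ∀ (V : WeierstrassCurve ℚ) [V.IsElliptic], p_parity V 2)
    (hCT : WeierstrassCurve.exists_casselsTate_pairing (K := ℚ)) (hΔ : 0 < W.Δ) (hT : NoRationalTwoTorsion W)
    (h4 : selmerTwoCard W = 4) :
    (∀ d : ℤ, DescAdmissible W d → twistSelmerTwoCard W d = 2) ∨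
      (∀ d : ℤ, DescAdmissible W d → twistSelmerTwoCard W d = 8) :=
  strictShaPropagationAt_of_isSquare W hΔ h4 fun _ hd ↦ isSquare_twistSelmerTwoCard_mul_selmerTwoCard_mul_two' W hmod hpar hCT hT hd

end R128Twins

end Summit.BirchSwinnertonDyer.BirchSwinnertonDyer.Theorems.GenusKolyArch

end
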